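import Literature.AlgebraicGeometry.AbelianSchemes.AbelianSchemeHomDescentKernelEq      -- ★ `exists_iso_comp_eq_of_comp_eq_one_iff` (the recognition iso `ε`, [MumfordAV1970] §7 Thm. 4)
import Literature.AlgebraicGeometry.AbelianSchemes.AbelianSchemeHomDescentPolarized      -- ★ `comp_lam_comp_dualIsogenyOver_eq_of_pullback_eq` (polarised recognition), ★ `comp_iso_eq_iso_comp_of_endo`
import Literature.AlgebraicGeometry.AbelianSchemes.DualIsogenyQuasiInverse                -- ★ `dualIsogenyOver_comp_dualIsogenyOver_eq_pow_id` (`ψ′ ≫ ψ = [n] ⟹ ψ^∨ ≫ ψ′^∨ = [n]`)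
import Literature.AlgebraicGeometry.AbelianSchemes.DualIsogenyDegree                      -- ★ `homOfIsMonHom`, `mulN_eq_hom_zsmul_id`, `IsIsogeny.exists_nsmul_inverse_holds`, `IsIsogeny.flat`
import Literature.AlgebraicGeometry.AbelianSchemes.IsogenyRoofTransportAlongIso           -- ★ §1 points along an iso (`map_eq_one_iff_of_iso_hom`, …), `dualIsogenyOver_comp`, `AlgPoints`
import HarnessLib

/-!
# ROOF-TARGET UNIQUENESS: two isogeny quotients `A —q→ B`, `A —q′→ B′` of ONE structured source with the SAME kernel are isomorphic
# under `A`, EXACTLY on the target structures `(λ_B, b_a, level points)`; the other leg of an isogeny roof moves along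

Topic `AlgebraicGeometry/AbelianSchemes`; namespace `Literature.AlgebraicGeometry.AbelianSchemes.AbelianSchemeOver`.  THEOREMS ONLY
(no definition, no named fact, no instance, no notation, no `sorry`).  Cell `hodgecm-mathlib` (D-0151), P6 «MOD programme», half A line L2
(closer leaf `Lines/F0_P6a_StubDOWN.lean` of the D-LINE socket `stub_DOWN`; LA2-plan (g0) letter (TW) «ROOF-TARGET UNIQUENESS» 2026-09-02T03:33:02Z,
census LA1-p04 (g0) 03:34:06Z; consumer LA2-p02 (g0)՚s `stub_TRANSLWD` ∕ LS leaflet §3b «`red₀ (translΩ y)` depends only on `red₀ y`», and L3՚s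
reduced roofs): the generic brick «the MIDDLE OBJECT of an isogeny roof `A —q→ B ←c— A″` (P6a reader `RoofΩ`, Defs ED. 3 :361) is determined by
`(A, Ker q)` together with ALL its target structures».  `--supports stmt-HodgeConjecture-24832`, count-neutral.  HONEST LABEL: HC_CM is proved only
modulo the 2 remaining named inputs (hLiu418 24832, h413 24833) until rung 0 closes; this file is general and discharges none of them.

THE MATHEMATICS ([MumfordAV1970] §7 Thm. 4 p. 72 «for a finite subgroup `K ⊂ X` there is a unique isogeny `X → X/K` with kernel `K`, through which
every homomorphism killing `K` factors uniquely»; §23 p. 231 «the polarisation descends uniquely»; [MumfordFogartyKirwan1994] Ch. 7 §2 Def. 7.2–7.3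
«triples up to isomorphism»; [Milne2005ShimuraVarieties] §14 pp. 124–125).  Let `q : A → B`, `q′ : A → B′` be homomorphisms of abelian schemes,
fppf (flat, surjective, quasi-compact), with the SAME KERNEL AS SUBGROUP FUNCTORS: `t ≫ q = 1 ↔ t ≫ q′ = 1` for every `T`-valued point `t` of `A`
(for the P6a roofs: both kernels are the whole `𝔭_{c•w}`-torsion `A[𝔭_{c•w}]`; over `Ω = Ω̄` of characteristic `0` equality on `Ω`-points suffices by ★
`EtaleKernelDecidedOnPoints`, in characteristic `p` it does NOT — `F_{A/k}` and `𝟙` have the same `Ω`-kernel).  Then (★ `AbelianSchemeHomDescentKernelEq`)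
there is a unique `ε : B ⥲ B′` with `q ≫ ε = q′`, a homomorphism, and `ε` MATCHES THE TARGET STRUCTURES:
* (r3′) POLARISATIONS: if `q ≫ λ_B ≫ q^∨ = λ ≫ [p] = q′ ≫ λ_{B′} ≫ q′^∨` (the two (r3) rows of the roofs, SAME right-hand side) then
  `ε ≫ λ_{B′} ≫ ε^∨ = λ_B` — ★ `comp_lam_comp_dualIsogenyOver_eq_of_pullback_eq` (cancel `q` on the left, `q^∨` on the right), whose quasi-inverse input
  `q^∨ ≫ χ′ = [n]` comes from a quasi-inverse `g` of the ISOGENY `q` (`q ≫ g = [n]`, `g ≫ q = [n]`, [MumfordAV1970] §19 Remark p. 169; over a field: ★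
  `IsIsogeny.exists_nsmul_inverse_holds`) dualised (★ `dualIsogenyOver_comp_dualIsogenyOver_eq_pow_id`);
* (r4′) ENDOMORPHISMS: any `α : A → A` intertwined by `q` with `b : B → B` and by `q′` with `b′ : B′ → B′` has `b ≫ ε = ε ≫ b′` (★ `comp_iso_eq_iso_comp_of_endo`:
  cancel the epimorphism `q`) — the (r4) rows `ι(a) ≫ q = q ≫ b_a`;
* (r5′) POINTS: `ε(q(P)) = q′(P)` for every point `P` (trivial) — the (r5) level rows.
Consequently (§4) the OTHER LEG of an isogeny roof moves along: if `A —q→ B ←c— A″` satisfies (r2) `Ker c(Ω) = tors″`, `c` surjective, (r3) for `c`,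
(r4) through common endomorphisms `b_a`, (r5) `q(σᵃ) = c(σ″ᵃ)`, then `A —q′→ B′ ←c ≫ ε— A″` satisfies the same clauses (ε detects the unit point, is a
homeomorphism, is exact on `λ`, conjugates `b_a`).  So two roofs `A —q→ B ←c₁— A″₁`, `A —q′→ B′ ←c₂— A″₂` with the same `q`-kernel give TWO legs
`c₁ ≫ ε`, `c₂` into the SAME structured middle `B′` — the input of the `c`-leg recognition ★ `SerreTensorRecognitionOfPoints` ∕ (L1′) `I.inj₀` downstream.
The clause texts are VERBATIM those of ★ `IsogenyRoofTransportAlongIso.roof_transport_along_iso` ∕ the P6a reader `RoofΩ` with the readers abstracted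
(`schΩOf ↦ A`, `fibreΩOf ↦ A.toAffine.toAbelianVariety`, `actΩOf … .hom.hom.hom ↦ act`, `IsIdealTorsionΩ ↦ tors`, `lvlPtΩOf ↦ pt`).

## Contents
* §1 (over a field `Ω`) `isIsogeny_homOfIsMonHom_of_isFinite_of_surjective`, **`exists_quasiInverse_of_isFinite_of_surjective`** (`q ≫ g = [n]_A`, `g ≫ q = [n]_B`,
  `n ≠ 0`, `g` a homomorphism), `exists_dualIsogenyOver_comp_eq_pow_id_of_isFinite_of_surjective` (`q^∨ ≫ g^∨ = [n]`: the `hχ` of ★ polarised recognition).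
* §2 (any base) (r4′) `comp_iso_eq_iso_comp_of_intertwined` and (r5′) `map_iso_map_eq_of_comp_eq` restated in the roof binder shapes (one-liners over ★).
* §3 (over a field `Ω`) **`roof_target_unique`** — THE HEAD: `∃ ε : B ≅ B′`, `q ≫ ε = q′`, homomorphism, unique, (r3′), (r4′), (r5′).
* §4 (over a field `Ω`) **`roof_leg_transport_along_target_iso`** — the `c`-leg clauses (r2)(surj)(r3)(r4)(r5) move from `(B, q, c)` to `(B′, q′, c ≫ ε)`;
  **`exists_roof_of_roof_of_comp_eq_one_iff`** — §3 + §4 assembled in the `∃ (B …)`-free reader shape.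

## References
* [MumfordAV1970] D. Mumford, *Abelian Varieties* (1970), §7 Thm. 4 (p. 72); §15 Thm. 1 (p. 143); §19 Remark p. 169; §23 (p. 231).
* [MumfordFogartyKirwan1994] D. Mumford, J. Fogarty, F. Kirwan, *Geometric Invariant Theory*, 3rd ed. (1994), Ch. 7 §2 Def. 7.2 (p. 129), Def. 7.3 (p. 130).
* [Milne2005ShimuraVarieties] J. S. Milne, *Introduction to Shimura varieties* (2005), §14 pp. 124–125.
* [GortzWedhorn2023] U. Görtz, T. Wedhorn, *Algebraic Geometry II* (2023), Prop. 27.176, Cor. 27.177, Prop. 27.190.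
* Tree: ★ `AbelianSchemeHomDescentKernelEq`, ★ `AbelianSchemeHomDescentPolarized`, ★ `AbelianSchemeHomDescentEquivariant`, ★ `DualIsogenyQuasiInverse`,
  ★ `DualIsogenyDegree`, ★ `IsogenyRoofTransportAlongIso`, ★ `RoofLegsIsogenyOfPolarization` (supplies `IsFinite`∕`Surjective` of the legs from (r3)+(r2)).
-/

set_option autoImplicit false

noncomputable section

-- Mathlib's `Over`/pull-back API is stated across semireducible wrappers (as in the ★ `AbelianSchemes/*` files).
set_option backward.isDefEq.respectTransparency false

universe u

open CategoryTheory CategoryTheory.Limits AlgebraicGeometry MonoidalCategory CartesianMonoidalCategory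
open scoped MonObj

namespace Literature.AlgebraicGeometry.AbelianSchemes

namespace AbelianSchemeOver

open Literature.AlgebraicGeometry.Motives (AlgPoints)
open Literature.AlgebraicGeometry.Motives.AbelianVariety (IsIsogeny)

/-! ### §1 Over a field: a finite surjective homomorphism of abelian schemes has a quasi-inverse, and so has its dual -/

section QuasiInverse

variable {Ω : Type u} [Field Ω] {A B : AbelianSchemeOver (Spec (.of Ω))} (q : A.X ⟶ B.X) [IsMonHom q]

/-- A homomorphism of abelian `Ω`-schemes with `q.left` finite surjective, read as a morphism of abelian varieties (★ `homOfIsMonHom`), IS AN ISOGENY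
(the tree՚s `IsIsogeny` = surjective ∧ finite; definitional). [cite: MumfordAV1970, §7 Thm. 4 (p. 72)] [cite: GortzWedhorn2023, Prop. 27.176 and Cor. 27.177] -/
theorem isIsogeny_homOfIsMonHom_of_isFinite_of_surjective [IsFinite q.left] [Surjective q.left] : IsIsogeny (homOfIsMonHom q) :=
  ⟨‹Surjective q.left›, ‹IsFinite q.left›⟩

/-- **QUASI-INVERSE OF A FINITE SURJECTIVE HOMOMORPHISM over a field**: there are a homomorphism `g : B → A` and `n ≠ 0` with `q ≫ g = [n]_A` and
`g ≫ q = [n]_B` ([MumfordAV1970] §19 Remark p. 169; ★ `IsIsogeny.exists_nsmul_inverse_holds` read back in `Over (Spec Ω)` through ★ `homOfIsMonHom`,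
★ `mulN_eq_hom_zsmul_id`). [cite: MumfordAV1970, §19 Remark p. 169] [cite: GortzWedhorn2023, Prop. 27.190] -/
theorem exists_quasiInverse_of_isFinite_of_surjective [IsFinite q.left] [Surjective q.left] :
    ∃ (g : B.X ⟶ A.X) (_ : IsMonHom g) (n : ℕ), n ≠ 0 ∧ q ≫ g = A.mulN n ∧ g ≫ q = B.mulN n := by
  obtain ⟨g, n, hn, h1, h2⟩ := IsIsogeny.exists_nsmul_inverse_holds (isIsogeny_homOfIsMonHom_of_isFinite_of_surjective q)
  refine ⟨g.hom.hom.hom, g.hom.hom.isMonHom_hom, n, hn.ne', ?_, ?_⟩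
  · rw [mulN_eq_hom_zsmul_id, natCast_zsmul]
    exact congrArg (fun f => f.hom.hom.hom) h1
  · rw [mulN_eq_hom_zsmul_id, natCast_zsmul]
    exact congrArg (fun f => f.hom.hom.hom) h2

/-- **THE DUAL OF A FINITE SURJECTIVE HOMOMORPHISM HAS A QUASI-INVERSE**: `q^∨ ≫ χ′ = [n]_{B̂}` for some `χ′` and `n ≠ 0` (dualise `g ≫ q = [n]_B`, ★
`dualIsogenyOver_comp_dualIsogenyOver_eq_pow_id`) — the `hχ` input of ★ polarised recognition `comp_lam_comp_dualIsogenyOver_eq_of_pullback_eq` for `ψ := q`.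
[cite: MumfordAV1970, §15 Thm. 1 (p. 143)] [cite: MumfordAV1970, §19 Remark p. 169] -/
theorem exists_dualIsogenyOver_comp_eq_pow_id_of_isFinite_of_surjective [IsFinite q.left] [Surjective q.left] (DA : A.DualPair) (DB : B.DualPair)
    (hDB : Nonempty ((Scheme.Modules.pullback (DualPair.unitHatSlice DB)).obj DB.P ≅ SheafOfModules.unit _)) :
    ∃ (χ' : DA.hat.X ⟶ DB.hat.X) (n : ℕ), n ≠ 0 ∧ DualPair.dualIsogenyOver q DA DB ≫ χ' = (𝟙 DB.hat.X) ^ n := by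
  obtain ⟨g, hg, n, hn, -, h2⟩ := exists_quasiInverse_of_isFinite_of_surjective q
  exact ⟨DualPair.dualIsogenyOver g DB DA, n, hn, dualIsogenyOver_comp_dualIsogenyOver_eq_pow_id q g DA DB hDB h2⟩

end QuasiInverse

/-! ### §2 Any base: (r4′) intertwined endomorphisms and (r5′) points along the recognition isomorphism -/

section AnyBase

variable {S : Scheme.{u}} (A : AbelianSchemeOver S) {B B' : AbelianSchemeOver S} (q : A.X ⟶ B.X) (q' : A.X ⟶ B'.X)
  [Flat q.left] [Surjective q.left] [QuasiCompact q.left] (ε : B.X ≅ B'.X) (hε : q ≫ ε.hom = q')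

include hε in
/-- **(r4′) THE `(r4)` ENDOMORPHISMS INTERTWINE**: for `α : A → A`, `b : B → B`, `b′ : B′ → B′` with `α ≫ q = q ≫ b` and `α ≫ q′ = q′ ≫ b′`, `b ≫ ε = ε ≫ b′`
(★ `comp_iso_eq_iso_comp_of_endo`: precompose with the epimorphism `q`).  In the roofs: `α = ι(a)`, `b = b_a`, `b′ = b′_a`.
[cite: MumfordAV1970, §7 Thm. 4 (p. 72)] [cite: MumfordFogartyKirwan1994, Ch. 7 §2 Definition 7.2 (p. 129)] -/
theorem comp_iso_eq_iso_comp_of_intertwined (α : A.X ⟶ A.X) (b : B.X ⟶ B.X) (b' : B'.X ⟶ B'.X) (hb : α ≫ q = q ≫ b) (hb' : α ≫ q' = q' ≫ b') :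
    b ≫ ε.hom = ε.hom ≫ b' :=
  (A.comp_iso_eq_iso_comp_of_endo q ε hε hb hb').1

omit [Flat q.left] [Surjective q.left] [QuasiCompact q.left] in
include hε in
/-- (r5′) **POINTS**: `t ≫ q ≫ ε = t ≫ q′` for every `T`-valued point `t` of `A` (trivial bookkeeping, recorded in the roof binder shape).
[cite: MumfordFogartyKirwan1994, Ch. 7 §2 Definition 7.3 (p. 130)] -/
theorem comp_comp_iso_eq_of_comp_eq {T : Over S} (t : T ⟶ A.X) : (t ≫ q) ≫ ε.hom = t ≫ q' := by
  rw [Category.assoc, hε]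

end AnyBase

/-! ### §3 THE HEAD over a field: the target of an isogeny quotient with its structures is unique -/

section Head

variable {Ω : Type u} [Field Ω] {A B B' : AbelianSchemeOver (Spec (.of Ω))}
  (DA : A.DualPair) (DB : B.DualPair) (DB' : B'.DualPair)
  (hDB : Nonempty ((Scheme.Modules.pullback (DualPair.unitHatSlice DB)).obj DB.P ≅ SheafOfModules.unit _))
  (hDB' : Nonempty ((Scheme.Modules.pullback (DualPair.unitHatSlice DB')).obj DB'.P ≅ SheafOfModules.unit _))
  (lam : A.X ⟶ DA.hat.X) (lamB : B.X ⟶ DB.hat.X) (lamB' : B'.X ⟶ DB'.hat.X)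
  (q : A.X ⟶ B.X) [IsMonHom q] (q' : A.X ⟶ B'.X) [IsMonHom q'] (p : ℕ)

include hDB hDB' in
/-- **ROOF-TARGET UNIQUENESS.**  Let `q : A → B`, `q′ : A → B′` be homomorphisms of abelian `Ω`-schemes, finite and surjective (isogenies — for the P6a roofs ★
`roof_legs_isFinite_surjective_of_polarization` supplies this from (r3)+(r2)), with the SAME KERNEL AS SUBGROUP FUNCTORS (`hker`), and let `λ : A → Â`, homomorphisms
`λ_B : B → B̂`, `λ_{B′} : B′ → B̂′` satisfy the two (r3) rows `q ≫ λ_B ≫ q^∨ = λ ≫ [p] = q′ ≫ λ_{B′} ≫ q′^∨`.  Then there is an isomorphism `ε : B ⥲ B′` over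
`Spec Ω` with `q ≫ ε = q′`, a HOMOMORPHISM, UNIQUE among factorisations, and EXACT on the target structures: (r3′) `ε ≫ λ_{B′} ≫ ε^∨ = λ_B`; (r4′) every
`α : A → A` intertwined with `b` by `q` and with `b′` by `q′` has `b ≫ ε = ε ≫ b′`; (r5′) `ε(q(P)) = q′(P)` on `Ω`-points.
(`ε`: ★ `exists_iso_comp_eq_of_comp_eq_one_iff` — `q`, `q′` are flat by ★ `IsIsogeny.flat`; (r3′): ★ `comp_lam_comp_dualIsogenyOver_eq_of_pullback_eq` with the
quasi-inverse of §1; (r4′): §2.) [cite: MumfordAV1970, §7 Thm. 4 (p. 72); §23 (p. 231)] [cite: MumfordAV1970, §15 Thm. 1 (p. 143)]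
[cite: MumfordFogartyKirwan1994, Ch. 7 §2 Definition 7.2 (p. 129) and Definition 7.3 (p. 130)] [cite: Milne2005ShimuraVarieties, §14 pp. 124–125] -/
theorem roof_target_unique [IsFinite q.left] [Surjective q.left] [IsFinite q'.left] [Surjective q'.left] [IsMonHom lamB] [IsMonHom lamB']
    (hker : ∀ ⦃T : Over (Spec (.of Ω))⦄ (t : T ⟶ A.X), t ≫ q = 1 ↔ t ≫ q' = 1)
    (r3 : q ≫ lamB ≫ DualPair.dualIsogenyOver q DA DB = lam ≫ DA.hat.mulN p)
    (r3' : q' ≫ lamB' ≫ DualPair.dualIsogenyOver q' DA DB' = lam ≫ DA.hat.mulN p) :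
    ∃ (ε : B.X ≅ B'.X) (_ : IsMonHom ε.hom), q ≫ ε.hom = q' ∧ (∀ χ : B.X ⟶ B'.X, q ≫ χ = q' → χ = ε.hom) ∧
      ε.hom ≫ lamB' ≫ DualPair.dualIsogenyOver ε.hom DB DB' = lamB ∧
      (∀ (α : A.X ⟶ A.X) (b : B.X ⟶ B.X) (b' : B'.X ⟶ B'.X), α ≫ q = q ≫ b → α ≫ q' = q' ≫ b' → b ≫ ε.hom = ε.hom ≫ b') ∧
      ∀ P : A.toAffine.toAbelianVariety.Points Ω,
        (AlgPoints.map ε.hom (AlgPoints.map q P : B.toAffine.toAbelianVariety.Points Ω) : B'.toAffine.toAbelianVariety.Points Ω) =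
          AlgPoints.map q' P := by
  -- the legs are isogenies, hence flat (★ `IsIsogeny.flat`); finite ⇒ affine ⇒ quasi-compact
  haveI : Flat q.left := IsIsogeny.flat (f := homOfIsMonHom q) ⟨‹_›, ‹_›⟩
  haveI : Flat q'.left := IsIsogeny.flat (f := homOfIsMonHom q') ⟨‹_›, ‹_›⟩
  -- the recognition isomorphism
  obtain ⟨ε, hε, hmon, huniq⟩ := A.exists_iso_comp_eq_of_comp_eq_one_iff q q' hker
  haveI := hmon
  haveI : IsMonHom (DualPair.dualIsogenyOver ε.hom DB DB') := DualPair.isMonHom_dualIsogenyOver ε.hom DB DB' hDB' hDB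
  -- (r3′): polarised recognition, fed by the quasi-inverse of `q^∨`
  obtain ⟨χ', n, hn, hχ⟩ := exists_dualIsogenyOver_comp_eq_pow_id_of_isFinite_of_surjective q DA DB hDB
  have hpull : q ≫ lamB ≫ DualPair.dualIsogenyOver q DA DB = (q ≫ ε.hom) ≫ lamB' ≫ DualPair.dualIsogenyOver (q ≫ ε.hom) DA DB' := by
    rw [r3, DualPair.dualIsogenyOver_congr DA DB' (h₂ := ‹IsMonHom q'›) hε, hε, r3']
  have hr3 : ε.hom ≫ lamB' ≫ DualPair.dualIsogenyOver ε.hom DB DB' = lamB :=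
    comp_lam_comp_dualIsogenyOver_eq_of_pullback_eq q DA DB' DB ε lamB' lamB χ' hn hχ hpull
  refine ⟨ε, hmon, hε, huniq, hr3, fun α b b' hb hb' => A.comp_iso_eq_iso_comp_of_intertwined q q' ε hε α b b' hb hb', fun P => ?_⟩
  -- (r5′)
  rw [← AlgPoints.map_comp_apply, hε]

end Head

/-! ### §4 The other leg of the roof moves along the target isomorphism; the assembled reader form -/

section Leg

variable {Ω : Type u} [Field Ω] {A A'' B B' : AbelianSchemeOver (Spec (.of Ω))}
  (DA'' : A''.DualPair) (DB : B.DualPair) (DB' : B'.DualPair)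
  (lam'' : A''.X ⟶ DA''.hat.X) (lamB : B.X ⟶ DB.hat.X) (lamB' : B'.X ⟶ DB'.hat.X)
  {O : Type*} (act : O → (A.X ⟶ A.X)) (act'' : O → (A''.X ⟶ A''.X))
  {J : Type*} (pt : J → A.toAffine.toAbelianVariety.Points Ω) (pt'' : J → A''.toAffine.toAbelianVariety.Points Ω)
  (tors'' : A''.toAffine.toAbelianVariety.Points Ω → Prop)
  (q : A.X ⟶ B.X) [IsMonHom q] (q' : A.X ⟶ B'.X) [IsMonHom q'] (c : A''.X ⟶ B.X) [IsMonHom c] (p : ℕ)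
  (ε : B.X ≅ B'.X) [IsMonHom ε.hom]

omit [IsMonHom q] [IsMonHom q'] in
/-- **THE OTHER LEG MOVES ALONG THE TARGET ISOMORPHISM.**  Let `ε : B ⥲ B′` be a homomorphism with `q ≫ ε = q′`, exact on `λ` (`ε ≫ λ_{B′} ≫ ε^∨ = λ_B`; e.g. the `ε`
of §3 `roof_target_unique`).  If the leg `c : A″ → B` satisfies (r2) `c(P) = 1 ↔ tors″ P`,
`c` surjective, (r3) `c ≫ λ_B ≫ c^∨ = λ″ ≫ [p]`, (r4) `∀ a ∃ b, ι(a) ≫ q = q ≫ b ∧ ι″(a) ≫ c = c ≫ b`, (r5) `q(σᵃ) = c(σ″ᵃ)`, then `c ≫ ε : A″ → B′` satisfies the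
same clauses for `(B′, q′)`: (r2) `ε` detects the unit point; surjectivity: `ε` is a homeomorphism; (r3) `(c ≫ ε)^∨ = ε^∨ ≫ c^∨` (★ `dualIsogenyOver_comp`) and
`hε`; (r4) with `b′ := ε⁻¹ ≫ b ≫ ε`; (r5) `ε(q σᵃ) = q′ σᵃ`. [cite: MumfordAV1970, §15 Thm. 1 (p. 143); §23 (p. 231)]
[cite: MumfordFogartyKirwan1994, Ch. 7 §2 Definition 7.2 (p. 129) and Definition 7.3 (p. 130)] [cite: Milne2005ShimuraVarieties, §14 pp. 124–125] -/
theorem roof_leg_transport_along_target_iso (hεq : q ≫ ε.hom = q')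
    (hε : ε.hom ≫ lamB' ≫ DualPair.dualIsogenyOver ε.hom DB DB' = lamB)
    (r2 : ∀ P : A''.toAffine.toAbelianVariety.Points Ω, (AlgPoints.map c P : B.toAffine.toAbelianVariety.Points Ω) = 1 ↔ tors'' P)
    (hsurj : Function.Surjective c.left.base)
    (r3c : c ≫ lamB ≫ DualPair.dualIsogenyOver c DA'' DB = lam'' ≫ DA''.hat.mulN p)
    (r4 : ∀ a : O, ∃ b : B.X ⟶ B.X, act a ≫ q = q ≫ b ∧ act'' a ≫ c = c ≫ b)
    (r5 : ∀ i : J, (AlgPoints.map q (pt i) : B.toAffine.toAbelianVariety.Points Ω) = AlgPoints.map c (pt'' i)) :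
    (∀ P : A''.toAffine.toAbelianVariety.Points Ω, (AlgPoints.map (c ≫ ε.hom) P : B'.toAffine.toAbelianVariety.Points Ω) = 1 ↔ tors'' P) ∧
      Function.Surjective (c ≫ ε.hom).left.base ∧
      (c ≫ ε.hom) ≫ lamB' ≫ DualPair.dualIsogenyOver (c ≫ ε.hom) DA'' DB' = lam'' ≫ DA''.hat.mulN p ∧
      (∀ a : O, ∃ b' : B'.X ⟶ B'.X, act a ≫ q' = q' ≫ b' ∧ act'' a ≫ (c ≫ ε.hom) = (c ≫ ε.hom) ≫ b') ∧
      ∀ i : J, (AlgPoints.map q' (pt i) : B'.toAffine.toAbelianVariety.Points Ω) = AlgPoints.map (c ≫ ε.hom) (pt'' i) := by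
  refine ⟨fun P => ?_, ?_, ?_, fun a => ?_, fun i => ?_⟩
  · -- (r2): `ε` detects the unit point
    rw [AlgPoints.map_comp_apply, map_eq_one_iff_of_iso_hom, r2]
  · -- surjectivity: `ε.hom.left` is an isomorphism of schemes
    haveI : IsIso ε.hom.left := (inferInstance : IsIso ((Over.forget _).map ε.hom))
    rw [Over.comp_left, Scheme.Hom.comp_base, TopCat.coe_comp]
    exact (TopCat.homeoOfIso (Scheme.forgetToTop.mapIso (asIso ε.hom.left))).surjective.comp hsurj
  · -- (r3) for `c ≫ ε`: `(c ≫ ε)^∨ = ε^∨ ≫ c^∨`, then `hε`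
    rw [DualPair.dualIsogenyOver_comp c ε.hom DA'' DB DB']
    simp only [Category.assoc]
    rw [← r3c, ← hε]
    simp only [Category.assoc]
  · -- (r4): conjugate the common endomorphism
    obtain ⟨b, hbq, hbc⟩ := r4 a
    refine ⟨ε.inv ≫ b ≫ ε.hom, ?_, ?_⟩
    · rw [← hεq, Category.assoc, ε.hom_inv_id_assoc, ← Category.assoc, hbq, Category.assoc]
    · rw [Category.assoc, ε.hom_inv_id_assoc, ← Category.assoc, hbc, Category.assoc]
  · -- (r5)
    rw [AlgPoints.map_comp_apply, ← r5 i, ← AlgPoints.map_comp_apply, hεq]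

end Leg

section Assembled

variable {Ω : Type u} [Field Ω] {A A'' B B' : AbelianSchemeOver (Spec (.of Ω))}
  (DA : A.DualPair) (DA'' : A''.DualPair) (DB : B.DualPair) (DB' : B'.DualPair)
  (hDB : Nonempty ((Scheme.Modules.pullback (DualPair.unitHatSlice DB)).obj DB.P ≅ SheafOfModules.unit _))
  (hDB' : Nonempty ((Scheme.Modules.pullback (DualPair.unitHatSlice DB')).obj DB'.P ≅ SheafOfModules.unit _))
  (lam : A.X ⟶ DA.hat.X) (lam'' : A''.X ⟶ DA''.hat.X) (lamB : B.X ⟶ DB.hat.X) (lamB' : B'.X ⟶ DB'.hat.X)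
  {O : Type*} (act : O → (A.X ⟶ A.X)) (act'' : O → (A''.X ⟶ A''.X))
  {J : Type*} (pt : J → A.toAffine.toAbelianVariety.Points Ω) (pt'' : J → A''.toAffine.toAbelianVariety.Points Ω)
  (tors'' : A''.toAffine.toAbelianVariety.Points Ω → Prop)
  (q : A.X ⟶ B.X) [IsMonHom q] (q' : A.X ⟶ B'.X) [IsMonHom q'] (c : A''.X ⟶ B.X) [IsMonHom c] (p : ℕ)

include hDB hDB' in
/-- **TWO ROOFS WITH THE SAME `q`-KERNEL SHARE THE MIDDLE, WITH ALL CLAUSES** (§3 + §4 assembled): from a roof `A —q→ B ←c— A″` with (r2)(surj)(r3-q)(r3-c)(r4)(r5)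
and a second finite surjective homomorphism `q′ : A → B′` with the same kernel functor and the (r3) row for `λ_{B′}`, the data `(B′, λ_{B′}, q′, c ≫ ε)` is a roof
`A —q′→ B′ ←c≫ε— A″` with the same clause texts (same `p`, same `tors″`, same `pt`, `pt″`) — so the targets `A″₁`, `A″₂` of two P6a roofs off the SAME `(A, Ker q)` both
map onto the SAME structured middle by legs with the prescribed kernels. [cite: MumfordAV1970, §7 Thm. 4 (p. 72); §23 (p. 231)]
[cite: MumfordFogartyKirwan1994, Ch. 7 §2 Definition 7.2 (p. 129) and Definition 7.3 (p. 130)] [cite: Milne2005ShimuraVarieties, §14 pp. 124–125] -/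
theorem exists_roof_of_roof_of_comp_eq_one_iff [IsFinite q.left] [Surjective q.left] [IsFinite q'.left] [Surjective q'.left]
    [IsMonHom lamB] [IsMonHom lamB']
    (hker : ∀ ⦃T : Over (Spec (.of Ω))⦄ (t : T ⟶ A.X), t ≫ q = 1 ↔ t ≫ q' = 1)
    (r3 : q ≫ lamB ≫ DualPair.dualIsogenyOver q DA DB = lam ≫ DA.hat.mulN p)
    (r3' : q' ≫ lamB' ≫ DualPair.dualIsogenyOver q' DA DB' = lam ≫ DA.hat.mulN p)
    (r2 : ∀ P : A''.toAffine.toAbelianVariety.Points Ω, (AlgPoints.map c P : B.toAffine.toAbelianVariety.Points Ω) = 1 ↔ tors'' P)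
    (hsurj : Function.Surjective c.left.base)
    (r3c : c ≫ lamB ≫ DualPair.dualIsogenyOver c DA'' DB = lam'' ≫ DA''.hat.mulN p)
    (r4 : ∀ a : O, ∃ b : B.X ⟶ B.X, act a ≫ q = q ≫ b ∧ act'' a ≫ c = c ≫ b)
    (r5 : ∀ i : J, (AlgPoints.map q (pt i) : B.toAffine.toAbelianVariety.Points Ω) = AlgPoints.map c (pt'' i)) :
    ∃ (ε : B.X ≅ B'.X) (_ : IsMonHom ε.hom), q ≫ ε.hom = q' ∧
      ε.hom ≫ lamB' ≫ DualPair.dualIsogenyOver ε.hom DB DB' = lamB ∧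
      (∀ P : A''.toAffine.toAbelianVariety.Points Ω, (AlgPoints.map (c ≫ ε.hom) P : B'.toAffine.toAbelianVariety.Points Ω) = 1 ↔ tors'' P) ∧
      Function.Surjective (c ≫ ε.hom).left.base ∧
      (c ≫ ε.hom) ≫ lamB' ≫ DualPair.dualIsogenyOver (c ≫ ε.hom) DA'' DB' = lam'' ≫ DA''.hat.mulN p ∧
      (∀ a : O, ∃ b' : B'.X ⟶ B'.X, act a ≫ q' = q' ≫ b' ∧ act'' a ≫ (c ≫ ε.hom) = (c ≫ ε.hom) ≫ b') ∧
      ∀ i : J, (AlgPoints.map q' (pt i) : B'.toAffine.toAbelianVariety.Points Ω) = AlgPoints.map (c ≫ ε.hom) (pt'' i) := by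
  obtain ⟨ε, hmon, hεq, -, hε, -, -⟩ := roof_target_unique DA DB DB' hDB hDB' lam lamB lamB' q q' p hker r3 r3'
  haveI := hmon
  exact ⟨ε, hmon, hεq, hε, roof_leg_transport_along_target_iso DA'' DB DB' lam'' lamB lamB' act act'' pt pt'' tors'' q q' c p ε hεq hε r2 hsurj
    r3c r4 r5⟩

end Assembled

end AbelianSchemeOver

end Literature.AlgebraicGeometry.AbelianSchemes

end
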